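import Literature.Analysis.SpecialFunctions.OblateSpheroidalWeakAngular
import Literature.Analysis.FunctionSpaces.LpPathRegularSelection
import Mathlib.Analysis.Calculus.Deriv.Star
import Mathlib.MeasureTheory.Integral.Prod
import HarnessLib

/-!
# Integrals over `L²([-1, 1] × 𝕋)` in polar coordinates and Green's identity on the sphere

Companions of `OblateSpheroidalWeakAngular.lean` (the polar pull-back `𝓛g ∈ L²([-1,1] × 𝕋_T)` of a
function `g(θ, φ)`, for the measure `dx ⊗ dhaar`, `haar` the Haar **probability** measure):

* `integral_sphereMeasure_polarFn` — `∫ 𝓛F = (1/T) ∫_0^π sin θ ∫_0^T F(θ, φ) dφ dθ`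
  (Fubini, `∫_𝕋 = (1/T)∫_0^T`, and the substitution `x = cos θ`);
* `norm_polarLp_sq` — `‖𝓛g‖² = (1/T) ∫_0^π sin θ ∫_0^T |g|²`;
* `inner_polarLp_eq` — `⟪𝓛g, 𝓛h⟫ = (1/T) ∫_0^π sin θ ∫_0^T conj(g) h`;
* **`inner_polarLp_laplacian`** (Green's identity on `S²` in coordinates): for `C²` data
  `(g, gθ, w = ∂_θ(sin θ gθ), gφ, gφφ)` `T`-periodic in `φ`, `h` continuous with
  `sin²θ h = -sin θ w - gφφ` (i.e. `h = -Δ_{S²} g` off the poles) and `|gφ| ≤ C|sin θ|`,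
  `⟪𝓛g, 𝓛h⟫ = (1/T) (∫_0^π ∫_0^T sin θ |gθ|² + ∫_0^π ∫_0^T |gφ|²/sin θ)` — the quadratic form
  `‖∇_{S²} g‖²` of DRSR §5.3 (the term `|∇̸Ψ|²` of the energy identities after Plancherel).

## References

* M. Dafermos, I. Rodnianski, Y. Shlapentokh-Rothman, arXiv:1402.7034, §5.2.1–§5.3.
  [DafermosRodnianskiShlapentokhrothman2014]
-/

noncomputable section

open Real Set Filter MeasureTheory Function AddCircle
open scoped Topology InnerProductSpace ComplexConjugate Interval

namespace Literature.Analysis.SpecialFunctions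

open Literature.Analysis.FunctionSpaces Literature.Analysis.Fourier

variable {T : ℝ} [hT : Fact (0 < T)]

/-! ### The basic integral formula -/

/-- `𝓛F` is integrable for continuous `F`. [folklore] -/
theorem integrable_polarFn {F : ℝ → ℝ → ℂ} (hF : Continuous (uncurry F)) :
    Integrable (polarFn T F) (sphereMeasure T) :=
  (memLp_polarFn T hF).integrable one_le_two

/-- On representatives `φ ∈ [0, T)`: the `φ`-integral of `𝓛F(x, ·)` is `∫_0^T F(arccos x, φ) dφ`.
[folklore] -/
theorem intervalIntegral_polarFn (F : ℝ → ℝ → ℂ) (x : ℝ) :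
    ∫ φ in (0 : ℝ)..T, polarFn T F (x, (φ : AddCircle T)) = ∫ φ in (0 : ℝ)..T, F (arccos x) φ := by
  have hae : ∀ᵐ φ : ℝ, φ ≠ T := compl_mem_ae_iff.2 (measure_singleton T)
  refine intervalIntegral.integral_congr_ae ?_
  filter_upwards [hae] with φ hne hφ
  rw [uIoc_of_le hT.out.le] at hφ
  rw [polarFn_apply_coe T F x ⟨hφ.1.le, lt_of_le_of_ne hφ.2 hne⟩]

/-- **`∫ 𝓛F d(dx ⊗ dhaar) = (1/T) ∫_0^π sin θ ∫_0^T F(θ, φ) dφ dθ`.** [folklore] -/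
theorem integral_sphereMeasure_polarFn {F : ℝ → ℝ → ℂ} (hF : Continuous (uncurry F)) :
    ∫ z, polarFn T F z ∂(sphereMeasure T) =
      ((1 / T : ℝ) : ℂ) * ∫ θ in (0 : ℝ)..π, (sin θ : ℂ) * ∫ φ in (0 : ℝ)..T, F θ φ := by
  rw [show sphereMeasure T = legendreMeasure.prod haarAddCircle from rfl,
    integral_prod _ (integrable_polarFn hF)]
  have hinner : ∀ x, ∫ y, polarFn T F (x, y) ∂haarAddCircle =
      ((1 / T : ℝ) : ℂ) * ∫ φ in (0 : ℝ)..T, F (arccos x) φ := fun x ↦ by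
    rw [integral_haarAddCircle_eq_intervalIntegral (fun y ↦ polarFn T F (x, y)),
      intervalIntegral_polarFn, Complex.real_smul]
  simp_rw [hinner]
  have hGc : Continuous fun x ↦ ∫ φ in (0 : ℝ)..T, F (arccos x) φ := by
    have hc : Continuous (uncurry fun x φ ↦ F (arccos x) φ) :=
      hF.comp (continuous_arccos.prodMap continuous_id)
    exact intervalIntegral.continuous_parametric_intervalIntegral_of_continuous' hc 0 T
  rw [integral_const_mul, integral_legendreMeasure_eq_intervalIntegral',
    ← integral_comp_cos hGc]
  congr 1
  refine intervalIntegral.integral_congr fun θ hθ ↦ ?_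
  rw [uIcc_of_le Real.pi_pos.le] at hθ
  simp only [arccos_cos hθ.1 hθ.2]

/-- **`‖𝓛g‖² = (1/T) ∫_0^π sin θ ∫_0^T |g(θ, φ)|² dφ dθ`.** [folklore] -/
theorem norm_polarLp_sq {g : ℝ → ℝ → ℂ} (hg : Continuous (uncurry g)) :
    ‖polarLp T g hg‖ ^ 2 = 1 / T * ∫ θ in (0 : ℝ)..π, sin θ * ∫ φ in (0 : ℝ)..T, ‖g θ φ‖ ^ 2 := by
  have h1 : ∫ z, ‖(polarLp T g hg : ℝ × AddCircle T → ℂ) z‖ ^ 2 ∂(sphereMeasure T) =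
      ‖polarLp T g hg‖ ^ 2 := integral_norm_sq_Lp _
  have h2 : ∫ z, ‖(polarLp T g hg : ℝ × AddCircle T → ℂ) z‖ ^ 2 ∂(sphereMeasure T) =
      ∫ z, ‖polarFn T g z‖ ^ 2 ∂(sphereMeasure T) :=
    integral_congr_ae ((coeFn_polarLp T g hg).mono fun z hz ↦ by simp only [hz])
  have hF : Continuous (uncurry fun θ φ ↦ ((‖g θ φ‖ ^ 2 : ℝ) : ℂ)) := by fun_prop
  have h3 := integral_sphereMeasure_polarFn (T := T) hF
  have h4 : ∫ z, polarFn T (fun θ φ ↦ ((‖g θ φ‖ ^ 2 : ℝ) : ℂ)) z ∂(sphereMeasure T) =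
      ((∫ z, ‖polarFn T g z‖ ^ 2 ∂(sphereMeasure T) : ℝ) : ℂ) := by
    rw [← integral_complex_ofReal]; rfl
  rw [← h1, h2]
  apply Complex.ofReal_injective
  rw [← h4, h3]
  push_cast
  congr 1
  rw [← intervalIntegral.integral_ofReal]
  refine intervalIntegral.integral_congr fun θ _ ↦ ?_
  push_cast
  rw [← intervalIntegral.integral_ofReal]
  push_cast
  rfl

/-- **`⟪𝓛g, 𝓛h⟫ = (1/T) ∫_0^π sin θ ∫_0^T conj(g) h`.** [folklore] -/
theorem inner_polarLp_eq {g h : ℝ → ℝ → ℂ} (hg : Continuous (uncurry g))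
    (hh : Continuous (uncurry h)) :
    ⟪polarLp T g hg, polarLp T h hh⟫_ℂ =
      ((1 / T : ℝ) : ℂ) * ∫ θ in (0 : ℝ)..π, (sin θ : ℂ) * ∫ φ in (0 : ℝ)..T,
        conj (g θ φ) * h θ φ := by
  rw [L2.inner_def]
  have h2 : ∫ z, ⟪(polarLp T g hg : ℝ × AddCircle T → ℂ) z,
      (polarLp T h hh : ℝ × AddCircle T → ℂ) z⟫_ℂ ∂(sphereMeasure T) =
      ∫ z, polarFn T (fun θ φ ↦ conj (g θ φ) * h θ φ) z ∂(sphereMeasure T) :=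
    integral_congr_ae (((coeFn_polarLp T g hg).and (coeFn_polarLp T h hh)).mono fun z hz ↦ by
      simp only [hz.1, hz.2, RCLike.inner_apply']; rfl)
  rw [h2, integral_sphereMeasure_polarFn (by fun_prop)]

/-! ### Green's identity on the sphere in coordinates -/

section Green

variable {g gθ w gφ gφφ h : ℝ → ℝ → ℂ}

omit hT in
/-- Swapping `∫_0^π ∫_0^T` for a jointly continuous integrand. [folklore] -/
theorem intervalIntegral_swap_of_continuous {F : ℝ → ℝ → ℂ} (hF : Continuous (uncurry F))
    (a b c d : ℝ) :
    ∫ x in a..b, ∫ y in c..d, F x y = ∫ y in c..d, ∫ x in a..b, F x y := by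
  refine intervalIntegral_intervalIntegral_swap ?_
  exact (hF.continuousOn.integrableOn_compact (isCompact_uIcc.prod isCompact_uIcc)).mono_set
    (prod_mono uIoc_subset_uIcc uIoc_subset_uIcc)

omit hT in
/-- **Periodic integration by parts in `φ`**: `∫_0^T conj(g) gφφ = -∫_0^T conj(gφ) gφ`.
[folklore] -/
theorem intervalIntegral_conj_mul_dd_periodic {u u₁ u₂ : ℝ → ℂ}
    (hu : ∀ φ, HasDerivAt u (u₁ φ) φ) (hu₁ : ∀ φ, HasDerivAt u₁ (u₂ φ) φ)
    (hcu₁ : Continuous u₁) (hcu₂ : Continuous u₂) (hper : u T = u 0) (hper₁ : u₁ T = u₁ 0) :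
    ∫ φ in (0 : ℝ)..T, conj (u φ) * u₂ φ = -∫ φ in (0 : ℝ)..T, conj (u₁ φ) * u₁ φ := by
  have hd : ∀ φ ∈ uIcc (0 : ℝ) T, HasDerivAt (fun φ ↦ conj (u φ)) (conj (u₁ φ)) φ :=
    fun φ _ ↦ (hu φ).star
  have h := intervalIntegral.integral_mul_deriv_eq_deriv_mul hd (fun φ _ ↦ hu₁ φ)
    ((RCLike.continuous_conj.comp hcu₁).intervalIntegrable _ _) (hcu₂.intervalIntegrable _ _)
  rw [h, hper, hper₁]
  ring

omit hT in
/-- **Integration by parts in `θ` against `∂_θ(sin θ ·)`**: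
`∫_0^π conj(g) w = -∫_0^π sin θ conj(gθ) gθ` for `w = ∂_θ(sin θ gθ)` (no boundary terms:
`sin 0 = sin π = 0`). [folklore] -/
theorem intervalIntegral_conj_mul_dSin {u u₁ v : ℝ → ℂ}
    (hu : ∀ θ, HasDerivAt u (u₁ θ) θ) (hv : ∀ θ, HasDerivAt (fun θ ↦ (sin θ : ℂ) * u₁ θ) (v θ) θ)
    (hcu₁ : Continuous u₁) (hcv : Continuous v) :
    ∫ θ in (0 : ℝ)..π, conj (u θ) * v θ =
      -∫ θ in (0 : ℝ)..π, (sin θ : ℂ) * (conj (u₁ θ) * u₁ θ) := by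
  have hd : ∀ θ ∈ uIcc (0 : ℝ) π, HasDerivAt (fun θ ↦ conj (u θ)) (conj (u₁ θ)) θ :=
    fun θ _ ↦ (hu θ).star
  have h := intervalIntegral.integral_mul_deriv_eq_deriv_mul hd (fun θ _ ↦ hv θ)
    ((RCLike.continuous_conj.comp hcu₁).intervalIntegrable _ _) (hcv.intervalIntegrable _ _)
  rw [h, sin_zero, sin_pi]
  simp only [Complex.ofReal_zero, zero_mul, mul_zero, sub_zero, zero_sub, neg_inj]
  refine intervalIntegral.integral_congr fun θ _ ↦ ?_
  ring

/-- **Green's identity on `S²` in coordinates**: for `C²` data `(g, gθ, w = ∂_θ(sin θ gθ), gφ, gφφ)`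
`T`-periodic in `φ`, `h` continuous with `sin²θ · h = -sin θ · w - gφφ` (`h = -Δ_{S²} g` off the
poles) and `|gφ| ≤ C|sin θ|`:
`⟪𝓛g, 𝓛h⟫ = (1/T) (∫_0^π ∫_0^T sin θ |gθ|² dφ dθ + ∫_0^π (∫_0^T |gφ|² dφ)/sin θ dθ)`.
[cite: DafermosRodnianskiShlapentokhrothman2014, §5.3 (the term `|∇̸Ψ|²`)] -/
theorem inner_polarLp_laplacian
    (hgθ : ∀ θ φ, HasDerivAt (fun θ ↦ g θ φ) (gθ θ φ) θ)
    (hw : ∀ θ φ, HasDerivAt (fun θ ↦ (sin θ : ℂ) * gθ θ φ) (w θ φ) θ)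
    (hgφ : ∀ θ φ, HasDerivAt (g θ) (gφ θ φ) φ)
    (hgφφ : ∀ θ φ, HasDerivAt (gφ θ) (gφφ θ φ) φ)
    (hcg : Continuous (uncurry g)) (hcgθ : Continuous (uncurry gθ))
    (hcw : Continuous (uncurry w)) (hcgφ : Continuous (uncurry gφ))
    (hcgφφ : Continuous (uncurry gφφ)) (hch : Continuous (uncurry h))
    (hper : ∀ θ φ, g θ (φ + T) = g θ φ) (hperφ : ∀ θ φ, gφ θ (φ + T) = gφ θ φ)
    (hrel : ∀ θ φ, (sin θ : ℂ) ^ 2 * h θ φ = -(sin θ : ℂ) * w θ φ - gφφ θ φ)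
    {C : ℝ} (hb : ∀ θ φ, ‖gφ θ φ‖ ≤ C * |sin θ|) :
    ⟪polarLp T g hcg, polarLp T h hch⟫_ℂ =
      ((1 / T : ℝ) : ℂ) *
        ((∫ θ in (0 : ℝ)..π, ∫ φ in (0 : ℝ)..T, (sin θ : ℂ) * (conj (gθ θ φ) * gθ θ φ)) +
          ∫ θ in (0 : ℝ)..π, (∫ φ in (0 : ℝ)..T, conj (gφ θ φ) * gφ θ φ) / (sin θ : ℂ)) := by
  rw [inner_polarLp_eq hcg hch]
  congr 1
  -- pointwise in `θ ∈ (0, π)`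
  have hpt : ∀ θ, sin θ ≠ 0 →
      (sin θ : ℂ) * ∫ φ in (0 : ℝ)..T, conj (g θ φ) * h θ φ =
        -(∫ φ in (0 : ℝ)..T, conj (g θ φ) * w θ φ) +
          (∫ φ in (0 : ℝ)..T, conj (gφ θ φ) * gφ θ φ) / (sin θ : ℂ) := by
    intro θ hs
    have hsc : (sin θ : ℂ) ≠ 0 := by exact_mod_cast hs
    have hibp := intervalIntegral_conj_mul_dd_periodic (T := T) (hgφ θ) (hgφφ θ)
      (hcgφ.uncurry_left θ) (hcgφφ.uncurry_left θ) (by simpa using hper θ 0)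
      (by simpa using hperφ θ 0)
    have h1 : (sin θ : ℂ) * ∫ φ in (0 : ℝ)..T, conj (g θ φ) * h θ φ =
        ∫ φ in (0 : ℝ)..T, (-(conj (g θ φ) * w θ φ) -
          (conj (g θ φ) * gφφ θ φ) / (sin θ : ℂ)) := by
      rw [← intervalIntegral.integral_const_mul]
      refine intervalIntegral.integral_congr fun φ _ ↦ ?_
      have hr := hrel θ φ
      field_simp
      linear_combination conj (g θ φ) * hr
    rw [h1, intervalIntegral.integral_sub, intervalIntegral.integral_neg,
      intervalIntegral.integral_div, hibp, neg_div, sub_neg_eq_add]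
    · exact ((RCLike.continuous_conj.comp (hcg.uncurry_left θ)).mul
        (hcw.uncurry_left θ)).neg.intervalIntegrable _ _
    · exact (((RCLike.continuous_conj.comp (hcg.uncurry_left θ)).mul
        (hcgφφ.uncurry_left θ)).div_const _).intervalIntegrable _ _
  -- the `θ`-integral: replace a.e.
  have hae : ∀ᵐ θ : ℝ, θ ∈ Ι (0 : ℝ) π →
      (sin θ : ℂ) * (∫ φ in (0 : ℝ)..T, conj (g θ φ) * h θ φ) =
        -(∫ φ in (0 : ℝ)..T, conj (g θ φ) * w θ φ) +
          (∫ φ in (0 : ℝ)..T, conj (gφ θ φ) * gφ θ φ) / (sin θ : ℂ) := by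
    have hπ : ∀ᵐ θ : ℝ, θ ≠ π := compl_mem_ae_iff.2 (measure_singleton π)
    filter_upwards [hπ] with θ hne hθ
    rw [uIoc_of_le Real.pi_pos.le] at hθ
    exact hpt θ (sin_pos_of_pos_of_lt_pi hθ.1 (lt_of_le_of_ne hθ.2 hne)).ne'
  rw [intervalIntegral.integral_congr_ae hae]
  -- integrability of the two pieces
  have hcont1 : Continuous fun θ ↦ ∫ φ in (0 : ℝ)..T, conj (g θ φ) * w θ φ :=
    intervalIntegral.continuous_parametric_intervalIntegral_of_continuous'
      ((RCLike.continuous_conj.comp hcg).mul hcw) 0 T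
  have hcont2 : Continuous fun θ ↦ ∫ φ in (0 : ℝ)..T, conj (gφ θ φ) * gφ θ φ :=
    intervalIntegral.continuous_parametric_intervalIntegral_of_continuous'
      ((RCLike.continuous_conj.comp hcgφ).mul hcgφ) 0 T
  have hint2 : IntervalIntegrable
      (fun θ ↦ (∫ φ in (0 : ℝ)..T, conj (gφ θ φ) * gφ θ φ) / (sin θ : ℂ)) volume 0 π := by
    refine IntervalIntegrable.mono_fun' (g := fun _ ↦ |T| * (C ^ 2 * 1))
      intervalIntegrable_const ?_ ?_
    · exact (hcont2.measurable.div
        (Complex.continuous_ofReal.comp continuous_sin).measurable).aestronglyMeasurable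
    · refine ae_of_all _ fun θ ↦ ?_
      simp only
      by_cases hs : sin θ = 0
      · simp [hs]; positivity
      rw [norm_div, Complex.norm_real, Real.norm_eq_abs, div_le_iff₀ (abs_pos.2 hs)]
      have hbound : ‖∫ φ in (0 : ℝ)..T, conj (gφ θ φ) * gφ θ φ‖ ≤
          (C * |sin θ|) ^ 2 * |T - 0| := by
        refine intervalIntegral.norm_integral_le_of_norm_le_const fun φ _ ↦ ?_
        rw [norm_mul, RCLike.norm_conj, ← sq]
        exact pow_le_pow_left₀ (norm_nonneg _) (hb θ φ) 2
      rw [sub_zero] at hbound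
      calc ‖∫ φ in (0 : ℝ)..T, conj (gφ θ φ) * gφ θ φ‖ ≤ |T| * (C * |sin θ|) ^ 2 := by
            rw [mul_comm]; exact hbound
        _ = |T| * (C ^ 2 * |sin θ|) * |sin θ| := by ring
        _ ≤ |T| * (C ^ 2 * 1) * |sin θ| := by
          gcongr
          exact abs_sin_le_one θ
  rw [intervalIntegral.integral_add (f := fun θ ↦ -∫ φ in (0 : ℝ)..T, conj (g θ φ) * w θ φ)
    (g := fun θ ↦ (∫ φ in (0 : ℝ)..T, conj (gφ θ φ) * gφ θ φ) / (sin θ : ℂ))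
    (hcont1.neg.intervalIntegrable _ _) hint2, intervalIntegral.integral_neg]
  congr 1
  -- the first piece: swap, integrate by parts in `θ`, swap back
  have hc1 : Continuous (uncurry fun θ φ ↦ conj (g θ φ) * w θ φ) :=
    (RCLike.continuous_conj.comp hcg).mul hcw
  have hc2 : Continuous (uncurry fun θ φ ↦ (sin θ : ℂ) * (conj (gθ θ φ) * gθ θ φ)) :=
    ((Complex.continuous_ofReal.comp continuous_sin).comp continuous_fst).mul
      ((RCLike.continuous_conj.comp hcgθ).mul hcgθ)
  rw [intervalIntegral_swap_of_continuous hc1, intervalIntegral_swap_of_continuous hc2,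
    ← intervalIntegral.integral_neg]
  refine intervalIntegral.integral_congr fun φ _ ↦ ?_
  rw [intervalIntegral_conj_mul_dSin (fun θ ↦ hgθ θ φ) (fun θ ↦ hw θ φ)
    (hcgθ.uncurry_right φ) (hcw.uncurry_right φ), neg_neg]

end Green

end Literature.Analysis.SpecialFunctions
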